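import Summits.RiemannHypothesis.RiemannHypothesis.Theses.RuelleBand
import Literature.NumberTheory.LFunctions.GeneralizedRH
import Literature.NumberTheory.DiophantineGeometry.NamedHypothesesRHProofs
import Literature.NumberTheory.LFunctions.RiemannHypothesisUpTo101

/-!
# `ExactFirstBand` (crux stmt-RiemannHypothesis-2061, route RuelleBand) — a counterexample has height `> 101`, kernel-checked

Negative-side support file of the crux disprover (cdisprove seat, cycle 1), sharpening `Reformulations.lean`
(`not_exactFirstBand_iff_exists_above_sixteen`, height `16`) with the tree's higher kernel-only certificate
`riemannHypothesisUpTo_hundredOne` (RH up to height `101`: `N(101) = 29 = N₀(101)`, Backlund certificate + Turing's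
reduction, checked by the kernel, standard axioms only).

* `re_eq_half_of_abs_im_le` — generic: RH up to height `T` controls both signs of `im s` in the open strip.
* `re_eq_half_of_abs_im_le_hundredOne`, `not_exactFirstBand_iff_exists_above_hundredOne` — UNCONDITIONALLY (kernel only)
  a kill of the crux is a zero with `1/2 < re s < 1` and `im s > 101`.
(The tree also certifies height `2516` — `riemannHypothesisUpTo_2516`, the 2000 Odlyzko–te Riele zeros — but with
`native_decide` auxiliary axioms; that version is kept in the crux work file `Cruxes/ExactFirstBand/Disproof.lean`.)
-/

noncomputable section

open Complex Set

namespace Summit.RiemannHypothesis.Cruxes.ExactFirstBand.Negative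

open Summit.RiemannHypothesis.RiemannHypothesis.Theses.RuelleBand
open Literature.NumberTheory.LFunctions
open Literature.NumberTheory.DiophantineGeometry (RiemannHypothesisUpTo)

/-- RH up to height `T` gives `re s = 1/2` for every zero of the open strip with `|im s| ≤ T`: negative heights by
conjugation (`RiemannHypothesisUpTo.re_eq_of_im_neg`, Mathlib `riemannZeta_conj`), height `0` by `ζ(σ) < 0` on
`(0,1)`. [cite: Titchmarsh1986, §2.12] -/
theorem re_eq_half_of_abs_im_le {T : ℝ} (hT : RiemannHypothesisUpTo T) {s : ℂ} (hs : riemannZeta s = 0)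
    (h0 : 0 < s.re) (h1 : s.re < 1) (hle : |s.im| ≤ T) : s.re = 1 / 2 := by
  rcases lt_trichotomy s.im 0 with him | him | him
  · exact hT.re_eq_of_im_neg hs him (by rwa [abs_of_neg him] at hle)
  · exact absurd hs (riemannZeta_ne_zero_of_im_eq_zero_of_pos_of_lt_one him h0 h1)
  · exact hT s hs him (by rwa [abs_of_pos him] at hle)

/-- BOUNDED SEARCH, KERNEL-CHECKED, height `101`: no counterexample with `|im s| ≤ 101`. [cite: Edwards1974, §6.6] -/
theorem re_eq_half_of_abs_im_le_hundredOne {s : ℂ} (hs : riemannZeta s = 0) (h0 : 0 < s.re) (h1 : s.re < 1)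
    (hle : |s.im| ≤ 101) : s.re = 1 / 2 :=
  re_eq_half_of_abs_im_le riemannHypothesisUpTo_hundredOne hs h0 h1 hle

/-- Generic counterexample normal form above a verified height `T`: `¬X ⟺` a zero with `1/2 < re s < 1`,
`im s > T` (reflection `s ↦ 1 - s` and conjugation move any off-line zero into the quadrant). [folklore] -/
theorem not_exactFirstBand_iff_exists_above {T : ℝ} (hT : RiemannHypothesisUpTo T) :
    ¬ ExactFirstBand ↔ ∃ s : ℂ, riemannZeta s = 0 ∧ 1 / 2 < s.re ∧ s.re < 1 ∧ T < s.im := by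
  constructor
  · intro h
    by_contra hne
    apply h
    intro s hs h0 h1
    by_contra hor
    push Not at hor
    obtain ⟨hhalf, him⟩ := hor
    -- move to the quadrant
    obtain ⟨u, hu, hu0, hu1, huim⟩ :
        ∃ u : ℂ, riemannZeta u = 0 ∧ 1 / 2 < u.re ∧ u.re < 1 ∧ 0 < u.im := by
      obtain ⟨w, hw, hw0, hw1, hwim⟩ :
          ∃ w : ℂ, riemannZeta w = 0 ∧ 1 / 2 < w.re ∧ w.re < 1 ∧ w.im ≠ 0 := by
        rcases lt_or_gt_of_ne hhalf with hlt | hgt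
        · refine ⟨1 - s, GeneralizedRH.riemannZeta_one_sub_eq_zero hs h0 h1, ?_, ?_, ?_⟩
          · simp only [sub_re, one_re]; linarith
          · simp only [sub_re, one_re]; linarith
          · simpa [sub_im] using him
        · exact ⟨s, hs, hgt, h1, him⟩
      rcases lt_or_gt_of_ne hwim with hneg | hpos
      · refine ⟨starRingEnd ℂ w, ?_, ?_, ?_, ?_⟩
        · rw [riemannZeta_conj, hw, map_zero]
        · simpa using hw0
        · simpa using hw1
        · rw [conj_im]; linarith
      · exact ⟨w, hw, hw0, hw1, hpos⟩
    refine hne ⟨u, hu, hu0, hu1, ?_⟩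
    by_contra hle
    have := re_eq_half_of_abs_im_le hT hu (by linarith) hu1 (by rw [abs_of_pos huim]; exact not_lt.1 hle)
    linarith
  · rintro ⟨s, hs, h0, h1, -⟩ h
    rcases h s hs (by linarith) h1 with h' | h'
    · linarith
    · -- a real zero in the open strip does not exist
      exact absurd hs (riemannZeta_ne_zero_of_im_eq_zero_of_pos_of_lt_one h' (by linarith) h1)

/-- COUNTEREXAMPLE NORMAL FORM, height `101` (unconditional, kernel only): a kill is a zero with `1/2 < re s < 1`
and `im s > 101`. [cite: Edwards1974, §6.6] -/
theorem not_exactFirstBand_iff_exists_above_hundredOne :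
    ¬ ExactFirstBand ↔ ∃ s : ℂ, riemannZeta s = 0 ∧ 1 / 2 < s.re ∧ s.re < 1 ∧ 101 < s.im :=
  not_exactFirstBand_iff_exists_above riemannHypothesisUpTo_hundredOne

end Summit.RiemannHypothesis.Cruxes.ExactFirstBand.Negative

end
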